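import Summits.Ventures.PercRepro.ProfileGapMonoThresholdWeakAverageCharge

/-!
# PercRepro — THE SUPPLY OF A RANK-`1` SET IN THE WEAK AVERAGED STEP AT `(2, 3)` (p5, gen 27;
`proofs/P5-GM1.md` §27)

For a rank-`1` set `B` of a loopless matroid (class `P = clF N B`, `X = E ∖ B`, `K = coloops X`, `Y = E ∖ P`) the
SUPPLY of `B` is the sum over `y ∈ Y` of its shares in the up-sets `insert y B`
(`ProfileGapMonoThresholdWeakAverageCharge`).  Its lower bounds:
* `sum_h_insert_ge` — the half-weights sum to at least `#Y (#B + 1) + [ρ(X) = 4] (κ − 1) · #(K ∖ P)`;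
* `supply_ge_sum_h`, `supply_eq_two_mul_of_two_le` — the supply is at least the half-weights, and exactly twice
  them when `#B ≥ 2`;
* `supply_ge_singleton_big` — a singleton `{b}` of a class with `≥ 2` points at `ρ(E∖b) = 4` takes the WHOLE
  weight of `{b, y}` for every coloop `y` of `E ∖ b` outside the class (its partner `{y}` is not demanding:
  `ρ(E∖y) = 3`), so its supply is at least `2 #Y + 2 κ · #(K ∖ P)`.
-/

open scoped Matroid

namespace PercRepro.Cogirth

open Finset ThmH Skew Shadow Profile

variable {α : Type} [DecidableEq α] {N : Matroid α} [N.Finite]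

section Supply

/-- The half-weights of the up-sets of `B`, summed over the points outside the class, are at least
`(#B + 1) #Y + [ρ(E∖B) = 4] (κ − 1) · #{coloops of E ∖ B outside the class}`. -/
theorem sum_h_insert_ge {B : Finset α} (hB : B ∈ Rq N 1) :
    (gr N \ clF N B).card * (B.card + 1) +
      (if rk N (gr N \ B) = 4 then
        ((coloops N (gr N \ B)).card - 1) * ((coloops N (gr N \ B)).filter (fun y => y ∉ clF N B)).card
      else 0) ≤
    ∑ y ∈ gr N \ clF N B,
      ((insert y B).card + (if rk N (gr N \ insert y B) = 3 then (coloops N (gr N \ insert y B)).card else 0)) := by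
  have hBg : B ⊆ gr N := (mem_Rq.1 hB).1
  have hX : gr N \ B ⊆ gr N := sdiff_subset
  -- the summand, rewritten
  have hterm : ∀ y ∈ gr N \ clF N B,
      (insert y B).card + (if rk N (gr N \ insert y B) = 3 then (coloops N (gr N \ insert y B)).card else 0) =
        (B.card + 1) + (if rk N ((gr N \ B).erase y) = 3 then (coloops N ((gr N \ B).erase y)).card else 0) := by
    intro y hy
    rw [card_insert_of_notMem (notMem_of_mem_sdiff_clF hBg hy), sdiff_insert_eq_erase]
  rw [sum_congr rfl hterm, sum_add_distrib, sum_const, smul_eq_mul]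
  apply Nat.add_le_add_left
  -- the death terms, restricted to the coloops outside the class
  set F := (coloops N (gr N \ B)).filter (fun y => y ∉ clF N B) with hF
  have hFY : F ⊆ gr N \ clF N B := by
    intro y hy
    rw [hF, mem_filter] at hy
    exact mem_sdiff.2 ⟨hX (coloops_subset _ hy.1), hy.2⟩
  calc (if rk N (gr N \ B) = 4 then ((coloops N (gr N \ B)).card - 1) * F.card else 0)
      ≤ ∑ y ∈ F, (if rk N ((gr N \ B).erase y) = 3 then (coloops N ((gr N \ B).erase y)).card else 0) := by
        split_ifs with h4
        · rw [mul_comm, ← smul_eq_mul, ← sum_const]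
          apply sum_le_sum
          intro y hy
          rw [hF, mem_filter] at hy
          have hr := rk_erase_of_mem_coloops hX hy.1
          rw [if_pos (by omega)]
          have := card_le_card (coloops_erase_subset_coloops_erase hX hy.1)
          rw [card_erase_of_mem hy.1] at this
          exact this
        · exact Nat.zero_le _
    _ ≤ ∑ y ∈ gr N \ clF N B,
          (if rk N ((gr N \ B).erase y) = 3 then (coloops N ((gr N \ B).erase y)).card else 0) :=
        sum_le_sum_of_subset_of_nonneg hFY (fun _ _ _ => Nat.zero_le _)

/-- The supply of `B` is at least the sum of the half-weights (every multiplier is `≥ 1`). -/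
theorem supply_ge_sum_h (B : Finset α) :
    ∑ y ∈ gr N \ clF N B,
        ((insert y B).card + (if rk N (gr N \ insert y B) = 3 then (coloops N (gr N \ insert y B)).card else 0)) ≤
      ∑ y ∈ gr N \ clF N B,
        (if B.card = 1 ∧ 4 ≤ rk N (gr N \ {y}) then 1 else 2) *
          ((insert y B).card +
            (if rk N (gr N \ insert y B) = 3 then (coloops N (gr N \ insert y B)).card else 0)) := by
  apply sum_le_sum
  intro y _
  split_ifs <;> omega

/-- The supply of a set with at least two points is twice the sum of the half-weights. -/
theorem supply_eq_two_mul_of_two_le {B : Finset α} (h2 : 2 ≤ B.card) :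
    2 * ∑ y ∈ gr N \ clF N B,
        ((insert y B).card + (if rk N (gr N \ insert y B) = 3 then (coloops N (gr N \ insert y B)).card else 0)) =
      ∑ y ∈ gr N \ clF N B,
        (if B.card = 1 ∧ 4 ≤ rk N (gr N \ {y}) then 1 else 2) *
          ((insert y B).card +
            (if rk N (gr N \ insert y B) = 3 then (coloops N (gr N \ insert y B)).card else 0)) := by
  rw [mul_sum]
  refine sum_congr rfl (fun y _ => ?_)
  rw [if_neg (show ¬ (B.card = 1 ∧ 4 ≤ rk N (gr N \ {y})) from fun h => by have := h.1; omega)]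

/-- **A singleton of a big class at `ρ(E∖b) = 4`**: every coloop `y` of `E ∖ b` outside the class has
`ρ(E∖y) = 3` (the partner `b'` of `b` spans `b`), so `{b, y}` has one claimant and `b` takes its whole weight
`2 (2 + κ(E∖{b,y})) ≥ 2 (κ + 1)`: the supply is at least `2 #Y + 2 κ · #{coloops outside the class}`. -/
theorem supply_ge_singleton_big (hloop : ∀ x ∈ gr N, rk N {x} = 1) {b : α} (hb : b ∈ gr N)
    (hP : 2 ≤ (clF N {b}).card) (h4 : rk N (gr N \ {b}) = 4) :
    2 * (gr N \ clF N {b}).card +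
      2 * (coloops N (gr N \ {b})).card *
        ((coloops N (gr N \ {b})).filter (fun y => y ∉ clF N {b})).card ≤
    ∑ y ∈ gr N \ clF N {b},
      (if ({b} : Finset α).card = 1 ∧ 4 ≤ rk N (gr N \ {y}) then 1 else 2) *
        ((insert y ({b} : Finset α)).card +
          (if rk N (gr N \ insert y {b}) = 3 then (coloops N (gr N \ insert y {b})).card else 0)) := by
  have hbg : ({b} : Finset α) ⊆ gr N := singleton_subset_iff.2 hb
  have h1 : rk N {b} = 1 := hloop b hb
  have hX : gr N \ {b} ⊆ gr N := sdiff_subset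
  set F := (coloops N (gr N \ {b})).filter (fun y => y ∉ clF N {b}) with hF
  have hFY : F ⊆ gr N \ clF N {b} := by
    intro y hy
    rw [hF, mem_filter] at hy
    exact mem_sdiff.2 ⟨hX (coloops_subset _ hy.1), hy.2⟩
  -- a partner `b'` of `b` in the class
  obtain ⟨b', hb'P, hb'b⟩ : ∃ b' ∈ clF N {b}, b' ≠ b := by
    have : 1 < (clF N {b}).card := by omega
    exact exists_mem_ne this b
  have hb'g : b' ∈ gr N := clF_subset_gr _ hb'P
  have hbb' : b ∈ clF N {b'} :=
    mem_clF_singleton_of_mem_clF hloop h1 (subset_clF hbg (mem_singleton_self b)) hb'P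
  -- the share of every `y ∈ F` is the full weight `2 (2 + κ(E∖{b,y}))`
  have hfull : ∀ y ∈ F,
      2 * (2 + ((coloops N (gr N \ {b})).card - 1)) ≤
        (if ({b} : Finset α).card = 1 ∧ 4 ≤ rk N (gr N \ {y}) then 1 else 2) *
          ((insert y ({b} : Finset α)).card +
            (if rk N (gr N \ insert y {b}) = 3 then (coloops N (gr N \ insert y {b})).card else 0)) := by
    intro y hy
    have hyF := hy
    rw [hF, mem_filter] at hy
    have hyX : y ∈ gr N \ {b} := coloops_subset _ hy.1
    have hyg : y ∈ gr N := hX hyX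
    have hyb : y ≠ b := fun h => (mem_sdiff.1 hyX).2 (by rw [h]; exact mem_singleton_self b)
    have hyb' : y ≠ b' := fun h => hy.2 (by rw [h]; exact hb'P)
    have hr3 : rk N ((gr N \ {b}).erase y) = 3 := by
      have := rk_erase_of_mem_coloops hX hy.1
      omega
    -- `ρ(E∖y) = 3`: `E ∖ y = insert b ((E ∖ b) ∖ y)` and `b'` is present
    have hEy : gr N \ {y} = insert b ((gr N \ {b}).erase y) := by
      ext x
      simp only [mem_sdiff, mem_singleton, mem_insert, mem_erase]
      constructor
      · rintro ⟨hx, hxy⟩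
        by_cases hxb : x = b
        · exact Or.inl hxb
        · exact Or.inr ⟨hxy, hx, hxb⟩
      · rintro (rfl | ⟨hxy, hx, _⟩)
        · exact ⟨hb, fun h => hyb h.symm⟩
        · exact ⟨hx, hxy⟩
    have hb'X : b' ∈ (gr N \ {b}).erase y :=
      mem_erase.2 ⟨fun h => hyb' h.symm, mem_sdiff.2 ⟨hb'g, by rwa [mem_singleton]⟩⟩
    have hrEy : rk N (gr N \ {y}) = 3 := by
      rw [hEy, rk_insert_of_mem_clF_singleton hb hbb' ((erase_subset _ _).trans hX) hb'X, hr3]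
    rw [if_neg (fun h => by omega), card_insert_of_notMem (by rwa [mem_singleton]), card_singleton,
      sdiff_insert_eq_erase, if_pos hr3]
    have := card_le_card (coloops_erase_subset_coloops_erase hX hy.1)
    rw [card_erase_of_mem hy.1] at this
    omega
  -- split the sum at `F`
  rw [← sum_sdiff hFY]
  have hrest : ∀ y ∈ (gr N \ clF N {b}) \ F, 2 ≤
      (if ({b} : Finset α).card = 1 ∧ 4 ≤ rk N (gr N \ {y}) then 1 else 2) *
        ((insert y ({b} : Finset α)).card +
          (if rk N (gr N \ insert y {b}) = 3 then (coloops N (gr N \ insert y {b})).card else 0)) := by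
    intro y hy
    have hyg : y ∈ gr N := (mem_sdiff.1 (mem_sdiff.1 hy).1).1
    have hyb : y ∉ ({b} : Finset α) := notMem_of_mem_sdiff_clF hbg (mem_sdiff.1 hy).1
    rw [card_insert_of_notMem hyb, card_singleton]
    split_ifs <;> omega
  have hA := sum_le_sum hrest
  have hB := sum_le_sum hfull
  rw [sum_const, smul_eq_mul] at hA hB
  rw [card_sdiff_of_subset hFY] at hA
  have hFle : F.card ≤ (gr N \ clF N {b}).card := card_le_card hFY
  -- `κ ≥ 1` when `F` is nonempty
  by_cases hF0 : F.card = 0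
  · rw [hF0, mul_zero, add_zero]
    rw [hF0] at hA
    omega
  · have hκ : 1 ≤ (coloops N (gr N \ {b})).card := by
      have : F.card ≤ (coloops N (gr N \ {b})).card := card_le_card (filter_subset _ _)
      omega
    have e1 : 2 * (2 + ((coloops N (gr N \ {b})).card - 1)) = 2 * (coloops N (gr N \ {b})).card + 2 := by
      omega
    rw [e1] at hB
    have hA' : 2 * (gr N \ clF N {b}).card ≤
        ∑ i ∈ (gr N \ clF N {b}) \ F,
          (if ({b} : Finset α).card = 1 ∧ 4 ≤ rk N (gr N \ {i}) then 1 else 2) *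
            ((insert i ({b} : Finset α)).card +
              (if rk N (gr N \ insert i {b}) = 3 then (coloops N (gr N \ insert i {b})).card else 0)) +
          2 * F.card := by
      omega
    linarith [hA', hB]

end Supply

end PercRepro.Cogirth
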